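import Summits.BirchSwinnertonDyer.Rank1Residual.X11b.AnticyclotomicEmbedding
import HarnessLib

/-!
# X11b, route R1 — the `Λ`-adic links with EVERY symbol a tree object: Cas18 Thm. 2.3 (control) and
# erratum Thm. 1.1 ∘ Cas18 Thm. 3.2 at the trivial character; the shadow retired for route R1

HONEST FRAMING (cell `b2b-bsdres`, run/shared/lean/b2b/bsd-rank1-residual/, verbatim in every
file): the goal of the cell is to DELETE the COMBINATION-SHAPED residual classes of the
Birch–Swinnerton-Dyer formula for ALL analytic-rank `≤ 1` elliptic curves over `ℚ` — "full BSD
formula for every rank `≤ 1` curve in class `C`" assembled STRICTLY from published theorems — so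
that the rank-`≤ 1` remainder becomes exactly the CONSTRUCTION-SHAPED classes, which are TYPED
(missing-input `Prop`s), NOT attempted. This is not "finishing BSD". Sub-cell
`b2b-bsdres-multr1-p1` (X11b, route R1); a RESEARCH ROUTE; no claim beyond the stated class; X11b
stays CONSTRUCTION-SHAPED; nothing here changes a label; no named fact (`Prop`-valued predicates
with parameters naming one PUBLISHED and one OPEN shape, and theorems; every result using the open
shape is CONDITIONAL; no `sorry`).

## What this file completes (gen 8)

Gen 1 typed the four `Λ`-adic links behind Castella's display — (IMC) erratum Thm. 1.1 at `𝟙`,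
(BDP) Cas18 Thm. 3.2, (CTL) Cas18 Thm. 2.3, (TAM-q) — on the SHADOW `LambdaAdicShadow =
(ord_p f_ac(0), ord_p L_p(f)(𝟙), ord_p log_ω P, ord_p ∏_{w∣N⁺} c_w)`. This generation put
`ord_p f_ac(0)` on the constructed module `X_ac(E[p^∞])` (`AnticyclotomicSelmerDual`,
`XAc.HasCharValuationAt`), `ord_p ∏_{w∣N⁺} c_w` on `tamagawaProductSplit` (`AnticyclotomicTamagawa`)
and `ord_p log_ω P` on `padicLogOrd` through THE embedding `K ↪ K_𝔭 = ℚ_p` (`AnticyclotomicEmbedding`).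
The only shadow number left, `ord_p L_p(f)(𝟙)` (Castella's BDP-type `p`-adic `L`-function at
`p ∣ N`, Cas18 Thm. 3.1 — NOT constructed: the analytic half of X11b's CONSTRUCTION-shaped residue),
occurs in exactly two links, (IMC) and (BDP), and is ELIMINATED by composing them. Hence:

* **`ControlOnTreeAt p κ 𝔭 γ ι P`** — (CTL), Cas18 Thm. 2.3 (`p ∣ N`, `Σ = ∅`, at `P`), PUB shape,
  EVERY SYMBOL A TREE OBJECT: "`X_ac(E[p^∞])` is `Λ`-torsion, and for a generator `f_ac` of its
  characteristic ideal `#ℤ_p/f_ac(0) = #Ш(E/K)[p^∞] · (#ℤ_p/((1 − a_p p⁻¹) log_{ω_E} P)/[E(K) ⊗ ℤ_p :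
  ℤ_p.P])² · ∏_{w∣N⁺} c_w^{(p)}(E/K)`" read in valuations (`ord_p(1 − a_p p⁻¹) = −1` at a
  multiplicative `p`): `ord_p f(0) = ord_p #Ш(E/K)[p^∞] + 2·((ord_p log_ω P − 1) − ord_p[E(K):ℤP]) +
  ord_p ∏_{w∣N⁺} c_w(E/K)`, with `X_ac = AcSelmer.XAc (E_K) p κ 𝔭 ∅ γ`, `ord_p log_ω P = padicLogOrd W
  p ι P`, `∏_{w∣N⁺} c_w = tamagawaProductSplit W K`, `Ш`, index Mathlib objects.
* **`IMCWaldspurgerOnTreeAt p κ 𝔭 γ ι P`** — (IMC) ∘ (BDP) at `𝟙`, OPEN ∘ PUB, every symbol a tree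
  object: "`ord_p f_ac(0) = ord_p L_p(f)(𝟙)`" [erratum Thm. 1.1 at `𝟙`, UNREFEREED ⇐ FW21 Thm. 4.41]
  ∘ "`L_p(f)(𝟙) = (1 − a_p p⁻¹)² · (log_{ω_E} P_K)²` up to a unit" [Cas18 Thm. 3.2 at `p ∣ N`, PUB] =
  `ord_p f(0) = 2·(ord_p log_ω P_K − 1)`. `[claim: Castella2018Erratum, status: under-review]`.
* `display52At_of_onTreeLinks` — the two ⟹ Castella's (5.2) (`Display52At`), the `f_ac`-witnesses
  glued by `XAc.HasCharValuationAt.unique`; `display53At_of_onTreeLinks` (+ erratum field ⟹ (5.3));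
  `shadow_of_onTreeLinks` — the gen-1 shadow `⟨n, 2(L−1), L, ord_p ∏_{w∣N⁺} c_w⟩` built from the tree
  numbers satisfies ALL FOUR gen-1 predicates (compatibility with every gen 1–7 consumer: the shadow
  is now an OUTPUT, not an input).
* CLASS LEVEL: `R1OpenInputOnTreeAt W p` (at every datum of `R1OpenInput52At` and every
  anticyclotomic `κ`, generator `γ`, degree-one prime `𝔭 ∋ p`, with THE embedding `embAt K p 𝔭`:
  `IMCWaldspurgerOnTreeAt`) [OPEN]; `R1ControlOnTreeAt W p` (same data: `ControlOnTreeAt`) [PUB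
  shape — Cas18 Thm. 2.3, whose printed hypotheses `rank E(K) = 1`, `#Ш(E/K)[p^∞] < ∞` hold at these
  data by Gross–Zagier–Kolyvagin for the erratum field (the route's named facts `hGZ`, `hGZK`,
  `hCST`)]; **`r1OpenInput52At_of_onTree`**: the two ⟹ `R1OpenInput52At W p` (κ, γ from
  `exists_anticyclotomic_generator_prime`, a degree-one `𝔭` from `degreeOne_of_splitsIn`: `p ∣ N_E`
  splits in an erratum field); **`R1.bsdp_of_onTree`**: the statement of record fed with them — on
  `R1Population` at `r_an = 1`, `BSD(E,p)` from NINE published named facts + the PUB-shaped (CTL)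
  input + the ONE open input (IMC∘BDP)@`𝟙`, every hypothesis now a statement about constructed
  objects. CONDITIONAL; deletes nothing; X11b stays CONSTRUCTION-SHAPED; no label change.

References: [Castella2018] Thm. 2.3, Thm. 3.2, §5 (5.1)–(5.3) (arXiv:1704.06608 pp. 5, 9, 12);
[Castella2018Erratum] Thm. 1.1 (p. 1); [JetchevSkinnerWan2017] Thm. 3.3.1.
-/

noncomputable section

open scoped Classical

open WeierstrassCurve NumberField IsDedekindDomain Literature.NumberTheory.EllipticCurves
  Literature.NumberTheory.EllipticCurves.ModularForms
  Literature.NumberTheory.EllipticCurves.Rank1Residual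
  Literature.NumberTheory.EllipticCurves.Rank1Residual.Typed
  Summit.BirchSwinnertonDyer.Rank1Residual.X11b.AcSelmer

namespace Summit.BirchSwinnertonDyer.Rank1Residual.X11b

/-! ### The two links at a datum, every symbol a tree object -/

section Links

variable {W : WeierstrassCurve ℚ} [W.IsElliptic] [W.IsGloballyMinimal] {K : Type} [Field K]
  [NumberField K]
variable (p : ℕ) [Fact p.Prime] (κ : ZpExtension K p) (𝔭 : HeightOneSpectrum (𝓞 K))
  (γ : Field.absoluteGaloisGroup K) [Fact (κ.IsTopGenerator γ)] (ι : K →+* ℚ_[p])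

/-- **(CTL) — Cas18 Thm. 2.3 (anticyclotomic control), `p ∣ N`, `Σ = ∅`, at `P`, EVERY SYMBOL A TREE
OBJECT — PUB shape** (Camb. J. Math. 6 (2018) Thm. 2.3, "this follows easily from the 'Anticyclotomic
Control Theorem' established in [JSW]" = JSW17 Thm. 3.3.1; not withdrawn by the erratum): "assume
that `rank_ℤ(E(K)) = 1` and that `#Ш(E/K)[p^∞] < ∞`. Then `X_ac(E[p^∞])` is `Λ`-torsion, and letting
`f_ac(T) ∈ Λ` be a generator of `Ch_Λ(X_ac(E[p^∞]))`, we have `#ℤ_p/f_ac(0) = #Ш(E/K)[p^∞] ·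
(#ℤ_p/((1 − a_p p⁻¹ + ε_p) log_{ω_E} P)/[E(K) ⊗ ℤ_p : ℤ_p.P])² × ∏_{w∣N⁺} c_w^{(p)}(E/K)`, where
`ε_p = 0` [at `p ∣ N`], `P ∈ E(K)` is any point of infinite order". In valuations (`a_p = ±1` at the
multiplicative `p`, so `ord_p(1 − a_p p⁻¹) = −1`): the module `X_ac = AcSelmer.XAc (E_K) p κ 𝔭 ∅ γ` is
torsion with a generator `f`, `f(0) ≠ 0`, `ord_p f(0) = ord_p #Ш(E/K)[p^∞] + 2·((ord_p log_ω P − 1) −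
ord_p[E(K):ℤP]) + ord_p ∏_{w∣N⁺} c_w(E/K)`, with `ord_p log_ω P = padicLogOrd W p ι P` (`ι` intended
to be THE embedding `embAt K p 𝔭` at the strict prime) and `∏_{w∣N⁺} c_w = tamagawaProductSplit W K`.
The printed hypotheses are carried by the consumer (on route R1 they hold by Gross–Zagier–Kolyvagin
for the erratum field). `K_∞`-formulation of `X_ac` (Shapiro). A predicate; nothing asserted; NOT a
named fact (consumed as a hypothesis). [cite: Castella2018, Thm. 2.3 (arXiv:1704.06608 p. 5) (shape only; nothing asserted)]
[cite: JetchevSkinnerWan2017, Thm. 3.3.1 (shape only; nothing asserted)] -/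
def ControlOnTreeAt (P : (W.baseChange K).toAffine.Point) : Prop :=
  ∃ n : ℕ, XAc.HasCharValuationAt (W.baseChange K) p κ 𝔭 ∅ γ n ∧
    (n : ℤ) = (padicValNat p (Nat.card (AddCommGroup.primaryComponent (W.baseChange K).sha p)) : ℤ) +
      2 * ((padicLogOrd W p ι P - 1) - (padicValNat p (AddSubgroup.zmultiples P).index : ℤ)) +
        padicValNat p (tamagawaProductSplit W K)

/-- **(IMC) ∘ (BDP) at the trivial character, EVERY SYMBOL A TREE OBJECT — OPEN ∘ PUB**: erratum
Thm. 1.1 ("`Ch_Λ(X_ac(E[p^∞]))Λ_{R₀} = (L_p(f))`", UNREFEREED ⇐ Fouquet–Wan arXiv:2107.13726 Thm. 4.41)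
evaluated at `𝟙`, `ord_p f_ac(0) = ord_p L_p(f)(𝟙)`, composed with Cas18 Thm. 3.2 at `p ∣ N` ("the
following equality holds up to a `p`-adic unit: `L_p(f,𝟙) = (1 − a_p p⁻¹ + ε_p)² · (log_{ω_E} P_K)²`",
PUB, `ε_p = 0`, `a_p = ±1`): `ord_p f(0) = 2·(ord_p log_{ω_E} P_K − 1)` for a generator `f` of the
characteristic ideal of the constructed `X_ac`, `ord_p log_ω` = `padicLogOrd` through `ι`. The
unconstructed `L_p(f)(𝟙)` is eliminated by the composition; what is OPEN is the first factor. THE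
open input of route R1 at a datum in its final typed form. A predicate; NEVER a theorem.
[claim: Castella2018Erratum, status: under-review]
[cite: Castella2018, Thm. 3.2 (arXiv:1704.06608 p. 9) and §5 (5.1) (p. 12) (shape only; nothing asserted)] -/
def IMCWaldspurgerOnTreeAt (P : (W.baseChange K).toAffine.Point) : Prop :=
  ∃ n : ℕ, XAc.HasCharValuationAt (W.baseChange K) p κ 𝔭 ∅ γ n ∧
    (n : ℤ) = 2 * (padicLogOrd W p ι P - 1)

variable {p κ 𝔭 γ ι}

/-- **Castella's (5.2) from the two tree-object links**: (IMC∘BDP)@`𝟙` [OPEN∘PUB] and (CTL) [PUB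
shape] at the same `(κ, γ, 𝔭, ι)` ⟹ `Display52At W p K P` ("combined with (5.1) immediately leads to
(5.2)"); the two generators' `ord_p f(0)` agree by `XAc.HasCharValuationAt.unique`. CONDITIONAL on the
open link. [cite: Castella2018, §5 (5.1)–(5.2) (arXiv:1704.06608 p. 12)] [cite: Castella2018Erratum, Thm. 1.1 (p. 1)] -/
theorem display52At_of_onTreeLinks {P : (W.baseChange K).toAffine.Point}
    (hIW : IMCWaldspurgerOnTreeAt p κ 𝔭 γ ι P) (hCTL : ControlOnTreeAt p κ 𝔭 γ ι P) :
    Display52At W p K P := by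
  obtain ⟨n, hn, hne⟩ := hIW
  obtain ⟨n', hn', hne'⟩ := hCTL
  obtain rfl : n = n' := hn.unique hn'
  unfold Display52At
  omega

/-- **… and (5.3) on an erratum field** (`p ≥ 5`, `q` multiplicative with `E[p]` ramified): the
Tamagawa step is the theorem `display53At_of_display52At`. CONDITIONAL on the open link.
[cite: Castella2018, §5 (5.1)–(5.3) (arXiv:1704.06608 p. 12)] -/
theorem display53At_of_onTreeLinks (hp : 5 ≤ p) {q : ℕ} [Fact q.Prime] (hmq : Mult W q)
    (hvq : ¬ p ∣ padicValInt q W.minimalDiscriminantInt) (hK : IsErratumField W K q)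
    {P : (W.baseChange K).toAffine.Point}
    (hIW : IMCWaldspurgerOnTreeAt p κ 𝔭 γ ι P) (hCTL : ControlOnTreeAt p κ 𝔭 γ ι P) :
    Display53At W p K P :=
  display53At_of_display52At hp hmq hvq hK (display52At_of_onTreeLinks hIW hCTL)

/-- **The gen-1 shadow is now an OUTPUT**: from the two tree-object links the shadow
`⟨ord_p f(0), 2(ord_p log_ω P − 1), ord_p log_ω P, ord_p ∏_{w∣N⁺} c_w⟩` satisfies all four gen-1
predicates — (IMC) and (BDP) by construction, (CTL) by `ControlOnTreeAt`, (TAM-q) by the theorem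
`padicValNat_tamagawaProductSplit_eq_of_isErratumField` — and the real-module forms of gen 8
(`IMCAtTrivialCharReal`, `ControlAtReal`). Compatibility with every consumer of
`CastellaErratumLinks` / `BDPRouteLinks` / `AnticyclotomicLinks`.
[cite: Castella2018, §5 (5.1)–(5.3) (arXiv:1704.06608 p. 12)] -/
theorem shadow_of_onTreeLinks (hp : 5 ≤ p) {q : ℕ} [Fact q.Prime] (hmq : Mult W q)
    (hvq : ¬ p ∣ padicValInt q W.minimalDiscriminantInt) (hK : IsErratumField W K q)
    {P : (W.baseChange K).toAffine.Point}
    (hIW : IMCWaldspurgerOnTreeAt p κ 𝔭 γ ι P) (hCTL : ControlOnTreeAt p κ 𝔭 γ ι P) :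
    ∃ S : LambdaAdicShadow W K P, S.logOrd = padicLogOrd W p ι P ∧
      S.tamSplitOrd = padicValNat p (tamagawaProductSplit W K) ∧
      XAc.HasCharValuationAt (W.baseChange K) p κ 𝔭 ∅ γ S.charValOrd.toNat ∧
      S.IMCAtTrivialChar ∧ S.WaldspurgerAt ∧ S.ControlAt p ∧ S.TamagawaAtRamifiedAt p ∧
      S.IMCAtTrivialCharReal p κ 𝔭 γ ∧ S.ControlAtReal p κ 𝔭 γ := by
  obtain ⟨n, hn, hne⟩ := hIW
  obtain ⟨n', hn', hne'⟩ := hCTL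
  obtain rfl : n = n' := hn.unique hn'
  refine ⟨⟨n, 2 * (padicLogOrd W p ι P - 1), padicLogOrd W p ι P,
      padicValNat p (tamagawaProductSplit W K)⟩, rfl, rfl, by simpa using hn, hne, rfl, hne', ?_,
    ⟨n, hn, hne⟩, ⟨n, hn, hne'⟩⟩
  exact LambdaAdicShadow.tamagawaAtRamifiedAt_of_eq_tamagawaProductSplit p _ (hp := hp) hmq hvq hK
    rfl

/-- The tree-object open link implies the real-module open link of `AnticyclotomicLinks` for the
output shadow (bookkeeping). [folklore] -/
theorem imcAtTrivialCharReal_of_onTree {P : (W.baseChange K).toAffine.Point}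
    (hIW : IMCWaldspurgerOnTreeAt p κ 𝔭 γ ι P) :
    (⟨0, 2 * (padicLogOrd W p ι P - 1), padicLogOrd W p ι P, 0⟩ : LambdaAdicShadow W K P).IMCAtTrivialCharReal
      p κ 𝔭 γ := by
  obtain ⟨n, hn, hne⟩ := hIW
  exact ⟨n, hn, hne⟩

end Links

/-! ### Class level: route R1's inputs with every symbol a tree object, and the statement of record -/

section ClassLevel

/-- **THE open input of route R1, every symbol a tree object — OPEN.** At every datum of
`R1OpenInput52At` (A′-hypotheses, `r_an = 1`, a non-split multiplicative `q ≠ p` with `E[p]`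
ramified, an erratum field `K` for `q` with [Cas20, §2.5]'s standing hypotheses at the tame level, a
Heegner datum of level `N_E` with `p ∤ c`, `P` its Heegner point, of infinite order) and for every
ANTICYCLOTOMIC `ℤ_p`-extension `κ` of `K`, topological generator `γ`, and prime `𝔭 ∋ p` of `𝓞_K` of
degree one (all of them: `p` splits), with THE embedding `embAt K p 𝔭 : K ↪ K_𝔭 = ℚ_p`:
`IMCWaldspurgerOnTreeAt` — "`ord_p f_ac(0) = 2·(ord_p log_{ω_E} P_K − 1)` for a generator `f_ac` of
`Ch_Λ(X_ac(E[p^∞]))`" [erratum Thm. 1.1 at `𝟙` (UNREFEREED ⇐ FW21 4.41) ∘ Cas18 Thm. 3.2 (PUB)].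
A predicate on `(W, p)`; NEVER a theorem; results using it are CONDITIONAL.
[claim: Castella2018Erratum, status: under-review] -/
def R1OpenInputOnTreeAt (W : WeierstrassCurve ℚ) [W.IsElliptic] [W.IsGloballyMinimal] (p : ℕ)
    [Fact p.Prime] : Prop :=
  ∀ [NeZero (W.conductorNorm ℤ)] (q : ℕ) [Fact q.Prime] (K : Type) [Field K] [NumberField K]
    (Dt : ModularParametrizationData W (W.conductorNorm ℤ))
    (H : HeegnerDatum (W.conductorNorm ℤ) (NumberField.discr K)) (ι : K →+* ℂ)
    (P : (W.baseChange K).toAffine.Point),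
    ErratumHypotheses W p → W.analyticRank = 1 → q ≠ p → Mult W q →
    ¬ W.HasSplitMultiplicativeReductionAtPrime q → ¬ p ∣ padicValInt q W.minimalDiscriminantInt →
    IsErratumField W K q → Cas20Standing K p (W.conductorNorm ℤ / p) →
    WeierstrassCurve.Affine.Point.map ι.toRatAlgHom P = heegnerPointComplex Dt H →
    ¬ (p : ℤ) ∣ Dt.c → ¬ IsOfFinAddOrder P →
    ∀ (κ : ZpExtension K p), κ.IsAnticyclotomic →
      ∀ (γ : Field.absoluteGaloisGroup K) [Fact (κ.IsTopGenerator γ)] (𝔭 : HeightOneSpectrum (𝓞 K))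
        (h𝔭 : ((p : ℕ) : 𝓞 K) ∈ 𝔭.asIdeal) (he : 𝔭.asIdeal.ramificationIdx (𝓞 ℚ) = 1)
        (hf : 𝔭.asIdeal.inertiaDeg (𝓞 ℚ) = 1),
        IMCWaldspurgerOnTreeAt p κ 𝔭 γ (embAt K p 𝔭 h𝔭 he hf) P

/-- **The control input of route R1, every symbol a tree object — PUB shape** (Cas18 Thm. 2.3 ⇐
JSW17 Thm. 3.3.1): at the same data, `ControlOnTreeAt`. Its printed hypotheses (`rank E(K) = 1`,
`#Ш(E/K)[p^∞] < ∞`; §2.1's standing `p ≥ 5`, irreducible, `p` split) hold at these data by the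
route's published facts (Gross–Zagier–Kolyvagin for the erratum field; the A′-hypotheses);
semistability (§2.1) is asserted for the non-semistable pairs by the erratum's "same argument" only
(cell record, `CastellaErratum.lean`). A predicate on `(W, p)`; nothing asserted; NOT a named fact
(consumed as a hypothesis). [cite: Castella2018, Thm. 2.3 (arXiv:1704.06608 p. 5) (shape only; nothing asserted)]
[cite: JetchevSkinnerWan2017, Thm. 3.3.1 (shape only; nothing asserted)] -/
def R1ControlOnTreeAt (W : WeierstrassCurve ℚ) [W.IsElliptic] [W.IsGloballyMinimal] (p : ℕ)
    [Fact p.Prime] : Prop :=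
  ∀ [NeZero (W.conductorNorm ℤ)] (q : ℕ) [Fact q.Prime] (K : Type) [Field K] [NumberField K]
    (Dt : ModularParametrizationData W (W.conductorNorm ℤ))
    (H : HeegnerDatum (W.conductorNorm ℤ) (NumberField.discr K)) (ι : K →+* ℂ)
    (P : (W.baseChange K).toAffine.Point),
    ErratumHypotheses W p → W.analyticRank = 1 → q ≠ p → Mult W q →
    ¬ W.HasSplitMultiplicativeReductionAtPrime q → ¬ p ∣ padicValInt q W.minimalDiscriminantInt →
    IsErratumField W K q → Cas20Standing K p (W.conductorNorm ℤ / p) →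
    WeierstrassCurve.Affine.Point.map ι.toRatAlgHom P = heegnerPointComplex Dt H →
    ¬ (p : ℤ) ∣ Dt.c → ¬ IsOfFinAddOrder P →
    ∀ (κ : ZpExtension K p), κ.IsAnticyclotomic →
      ∀ (γ : Field.absoluteGaloisGroup K) [Fact (κ.IsTopGenerator γ)] (𝔭 : HeightOneSpectrum (𝓞 K))
        (h𝔭 : ((p : ℕ) : 𝓞 K) ∈ 𝔭.asIdeal) (he : 𝔭.asIdeal.ramificationIdx (𝓞 ℚ) = 1)
        (hf : 𝔭.asIdeal.inertiaDeg (𝓞 ℚ) = 1),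
        ControlOnTreeAt p κ 𝔭 γ (embAt K p 𝔭 h𝔭 he hf) P

/-- **The tree-object inputs give the (5.2)-form open input**: `R1OpenInputOnTreeAt ∧
R1ControlOnTreeAt ⟹ R1OpenInput52At` — at each datum pick an anticyclotomic `κ`, a generator `γ`
(`exists_anticyclotomic_generator_prime`: global reciprocity, surjectivity of `κ`) and a prime
`𝔭 ∋ p`, of degree one because `p ∣ N_E` (`p` multiplicative) splits in the erratum field
(`degreeOne_of_splitsIn`), then `display52At_of_onTreeLinks`. (Hence also `R1OpenInputAt`, gen 7's
form, by `r1OpenInputAt_of_r1OpenInput52At`.) [cite: Castella2018, §5 (5.1)–(5.2) (arXiv:1704.06608 p. 12)]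
[cite: Castella2018Erratum, Thm. 1.1 (p. 1)] -/
theorem r1OpenInput52At_of_onTree {W : WeierstrassCurve ℚ} [W.IsElliptic] [W.IsGloballyMinimal]
    {p : ℕ} [Fact p.Prime] (hA : R1OpenInputOnTreeAt W p) (hC : R1ControlOnTreeAt W p) :
    R1OpenInput52At W p := by
  intro _ q _ K _ _ Dt H ι P hE hr hqp hmq hns hvq hK hCas hP hc hinf
  have hpN : p ∣ W.conductorNorm ℤ := dvd_conductorNorm_of_mult hE.2.1
  have hsplit : SplitsIn K p := hK.2.2.1 p (Fact.out : p.Prime) hpN (Ne.symm hqp)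
  obtain ⟨κ, γ, 𝔭, hκ, hγ, h𝔭⟩ := exists_anticyclotomic_generator_prime (p := p) hK.1
  haveI : Fact (κ.IsTopGenerator γ) := ⟨hγ⟩
  obtain ⟨he, hf⟩ := degreeOne_of_splitsIn hK.1.1 hsplit h𝔭
  exact display52At_of_onTreeLinks
    (hA q K Dt H ι P hE hr hqp hmq hns hvq hK hCas hP hc hinf κ hκ γ 𝔭 h𝔭 he hf)
    (hC q K Dt H ι P hE hr hqp hmq hns hvq hK hCas hP hc hinf κ hκ γ 𝔭 h𝔭 he hf)

/-- **Route R1 — statement of record, every input a statement about constructed objects.** For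
every globally minimal elliptic `W/ℚ` and prime `p` on `R1Population` with `ord_{s=1} L(E,s) = 1`:
`BSD(E,p)`, from the NINE PUBLISHED named facts of `R1.bsdp` (Gross–Zagier 1986 I.7.3, GZK, Skinner
2016 Thm. C, modularity, Cai–Shu–Tian 2014 Thm. 1.1, Friedberg–Hoffstein 1995 Thm. B, Mazur 1978
Cor. 4.1, Néron mapping property), the PUB-SHAPED input `R1ControlOnTreeAt` (Cas18 Thm. 2.3 on the
constructed `X_ac`, the formal logarithm and `∏_{w∣N⁺} c_w` of the tree) and the ONE OPEN input
`R1OpenInputOnTreeAt` ((IMC)∘(BDP) at `𝟙`: erratum Thm. 1.1 ⇐ [FW21, Thm. 4.41], PREPRINT, composed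
with Cas18 Thm. 3.2). Every other link of Castella §5 — (B) Gross–Zagier paraphrase, (C) Tamagawa
relation, (TAM-q), twist transport, the Heegner point, the Manin package, Thm. 1.1's hypotheses
(i)–(iv), FW21's "absolutely irreducible", [Cas20 §2.5] — is a tree theorem. CONDITIONAL; deletes
nothing; X11b stays CONSTRUCTION-SHAPED; no label change.
[cite: Castella2018, §5 (arXiv:1704.06608 p. 12)] [cite: Castella2018Erratum, Thm. 1.1, Thm. A′ (p. 1)]
[cite: Castella2020JIMJ, §2.5 (author PDF p. 8) and Thm. 2.11 (p. 12)] -/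
theorem R1.bsdp_of_onTree
    (hGZ : GrossZagier1986_thm_I_7_3) (hGZK : rank_eq_analyticRank_of_analyticRank_le_one)
    (hSk : Skinner2016.thmC_padicValRat_bsd_rank_zero) (hmod : exists_isNewformOf)
    (hCST : CaiShuTian2014.thm11_trivialChar)
    (hFH : friedbergHoffstein_exists_twist_ne_zero_ramifiedAt)
    (hMaz : mazur_not_dvd_maninConstant_of_odd) (hNS : integral_neronScaling_of_isGloballyMinimal)
    (hC : ∀ (W : WeierstrassCurve ℚ) [W.IsElliptic] [W.IsGloballyMinimal] (p : ℕ) [Fact p.Prime],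
      R1ControlOnTreeAt W p)
    (hA : ∀ (W : WeierstrassCurve ℚ) [W.IsElliptic] [W.IsGloballyMinimal] (p : ℕ) [Fact p.Prime],
      R1OpenInputOnTreeAt W p)
    (W : WeierstrassCurve ℚ) [W.IsElliptic] [W.IsGloballyMinimal] (p : ℕ) [Fact p.Prime]
    (hW : R1Population W p) (hr : W.analyticRank = 1) : BSDp W p :=
  R1.bsdp_of_openInput52 hGZ hGZK hSk hmod hCST hFH hMaz hNS
    (fun W _ _ p _ ↦ r1OpenInput52At_of_onTree (hA W p) (hC W p)) W p hW hr

end ClassLevel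

end Summit.BirchSwinnertonDyer.Rank1Residual.X11b

end
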